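import Mathlib.Tactic.FinCases
import Literature.Computability.MetaComplexity.BoundedArithSyntax
import HarnessLib

/-!
# Buss's classes `Σᵇᵢ / Πᵇᵢ` are stable under relabelling and substitution

Trunk: CplxMeta (G14), topic `Literature/Computability/MetaComplexity` (companion of
`BoundedArithSyntax.lean`).

Mathlib's `BoundedFormula.relabel g` (`g : α → β ⊕ Fin m`) renames the free variables of a
bounded formula, possibly turning some of them into (outer) in-context variables; its special
case `Formula.relabel` renames the free variables of a formula.  These are the operations by
which a formula with parameters is instantiated, its variables permuted or identified, and its
distinguished variable bound by a bounded quantifier (`ballLE`, `bexLE` take the quantified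
variable in context).  We show that the bounded quantifiers commute with relabelling
(`relabel_ballLE`, `relabel_bexLE`, `relabel_ballLELen`, `relabel_bexLELen`) and that Buss's
classes of sharply bounded, `Σᵇᵢ`, `Πᵇᵢ` and bounded formulas are stable under it
(`IsSharplyBounded.relabel`, `IsSigmab.relabel`, `IsPib.relabel`, `IsBounded.relabel`, and the
`Formula.relabel` forms `IsSigmab.formulaRelabel`, `IsPib.formulaRelabel`), as asserted in
Buss 1986, §2.1 (the classes are closed under renaming of variables / term substitution).
The same is done for Mathlib's `BoundedFormula.subst` (substitution of terms for the free
variables): `subst_ballLE`, `subst_bexLE`, `subst_ballLELen`, `subst_bexLELen`,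
`IsSharplyBounded.subst`, `IsSigmab.subst`, `IsPib.subst`, `IsBounded.subst`.

## References

* S. R. Buss, *Bounded Arithmetic*, Bibliopolis 1986, §2.1.
* J. Krajíček, *Bounded Arithmetic, Propositional Logic and Complexity Theory*, CUP 1995,
  Def. 5.2.1–5.2.2.
-/

namespace Literature.Computability.MetaComplexity

open FirstOrder FirstOrder.Language FirstOrder.Language.BoundedFormula

/-! ## Relabelling commutes with the bounded quantifiers -/

section General

variable {L : Language} {α β : Type} {m n : ℕ}

/-- Weakening a term by a new last context variable commutes with `relabelAux`. [folklore] -/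
theorem relabel_castSucc_relabel_relabelAux (g : α → β ⊕ Fin m) (t : L.Term (α ⊕ Fin n)) :
    (t.relabel (Sum.map id Fin.castSucc)).relabel (relabelAux g (n + 1)) =
      (t.relabel (relabelAux g n)).relabel
        (Sum.map id (Fin.castSucc : Fin (m + n) → Fin (m + n + 1))) := by
  rw [Term.relabel_relabel, Term.relabel_relabel]
  congr 1
  funext x
  rcases x with a | k
  · simp only [relabelAux, Function.comp_apply, Sum.map_inl, id_eq]
    rcases g a with b | c
    · simp
    · simp only [Equiv.sumAssoc_apply_inl_inr, Sum.map_inr, Sum.inr.injEq]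
      ext
      simp
  · simp only [relabelAux, Function.comp_apply, Sum.map_inr, Equiv.sumAssoc_apply_inr,
      finSumFinEquiv_apply_right, Sum.inr.injEq]
    ext
    simp

/-- The last context variable is sent to the last context variable by `relabelAux`. [folklore] -/
theorem relabelAux_inr_last (g : α → β ⊕ Fin m) :
    relabelAux g (n + 1) (Sum.inr (Fin.last n)) = Sum.inr (Fin.last (m + n)) := by
  simp only [relabelAux, Function.comp_apply, Sum.map_inr, id_eq, Equiv.sumAssoc_apply_inr,
    finSumFinEquiv_apply_right, Fin.natAdd_last]

variable [L.IsOrdered]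

/-- Relabelling an atomic inequality `t₁ ≤ t₂`. [folklore] -/
theorem relabel_le (g : α → β ⊕ Fin m) (t₁ t₂ : L.Term (α ⊕ Fin n)) :
    (Term.le t₁ t₂ : L.BoundedFormula α n).relabel g =
      Term.le (t₁.relabel (relabelAux g n)) (t₂.relabel (relabelAux g n)) := by
  simp only [Term.le, Relations.boundedFormula₂, Relations.boundedFormula]
  rw [BoundedFormula.relabel]
  simp only [mapTermRel, id_eq]
  congr 1
  funext i
  fin_cases i <;> rfl

/-- Relabelling commutes with the bounded universal quantifier. [folklore] -/
@[simp] theorem relabel_ballLE (g : α → β ⊕ Fin m) (t : L.Term (α ⊕ Fin n))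
    (φ : L.BoundedFormula α (n + 1)) :
    (ballLE t φ).relabel g = ballLE (t.relabel (relabelAux g n)) (φ.relabel g) := by
  simp only [ballLE, relabel_all, relabel_imp, relabel_le, Function.comp_apply, Term.relabel,
    relabelAux_inr_last, relabel_castSucc_relabel_relabelAux]

/-- Relabelling commutes with the bounded existential quantifier. [folklore] -/
@[simp] theorem relabel_bexLE (g : α → β ⊕ Fin m) (t : L.Term (α ⊕ Fin n))
    (φ : L.BoundedFormula α (n + 1)) :
    (bexLE t φ).relabel g = bexLE (t.relabel (relabelAux g n)) (φ.relabel g) := by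
  simp only [bexLE, relabel_ex]
  change ((Term.le _ _ ⊓ φ).relabel g).ex = _
  congr 1
  change ((Term.le _ _ ⟹ (φ ⟹ ⊥)) ⟹ ⊥).relabel g = (Term.le _ _ ⟹ (φ.relabel g ⟹ ⊥)) ⟹ ⊥
  simp only [relabel_imp, relabel_bot, relabel_le, Function.comp_apply, Term.relabel,
    relabelAux_inr_last, relabel_castSucc_relabel_relabelAux]

end General

/-! ## The language of bounded arithmetic -/

section BoundedArith

variable {α β : Type} {m n : ℕ}

/-- Relabelling commutes with the length term former `|·|`. [folklore] -/
private theorem relabel_len {γ δ : Type} (r : γ → δ) (t : Language.boundedArith.Term γ) :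
    (Term.len t).relabel r = Term.len (t.relabel r) := by
  simp only [Term.len, Functions.apply₁, Term.relabel]
  congr 1
  funext j
  fin_cases j
  rfl

/-- Relabelling commutes with the sharply bounded universal quantifier. [folklore] -/
@[simp] theorem relabel_ballLELen (g : α → β ⊕ Fin m)
    (t : Language.boundedArith.Term (α ⊕ Fin n))
    (φ : Language.boundedArith.BoundedFormula α (n + 1)) :
    (ballLELen t φ).relabel g = ballLELen (t.relabel (relabelAux g n)) (φ.relabel g) := by
  simp only [ballLELen, relabel_ballLE, relabel_len]

/-- Relabelling commutes with the sharply bounded existential quantifier. [folklore] -/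
@[simp] theorem relabel_bexLELen (g : α → β ⊕ Fin m)
    (t : Language.boundedArith.Term (α ⊕ Fin n))
    (φ : Language.boundedArith.BoundedFormula α (n + 1)) :
    (bexLELen t φ).relabel g = bexLELen (t.relabel (relabelAux g n)) (φ.relabel g) := by
  simp only [bexLELen, relabel_bexLE, relabel_len]

/-- Sharply bounded formulas are stable under relabelling of variables (Buss 1986, §2.1: the
classes are closed under renaming of variables). [cite: Buss1986, §2.1] -/
theorem IsSharplyBounded.relabel {φ : Language.boundedArith.BoundedFormula α n}
    (h : IsSharplyBounded φ) :
    ∀ {m : ℕ} (g : α → β ⊕ Fin m), IsSharplyBounded (φ.relabel g) := by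
  induction h with
  | of_isQF h => exact fun g => .of_isQF (h.relabel g)
  | imp _ _ ih₁ ih₂ =>
    intro m g
    rw [relabel_imp]
    exact .imp (ih₁ g) (ih₂ g)
  | ballLELen t _ ih =>
    intro m g
    rw [relabel_ballLELen]
    exact .ballLELen _ (ih g)
  | bexLELen t _ ih =>
    intro m g
    rw [relabel_bexLELen]
    exact .bexLELen _ (ih g)

/-- `Σᵇᵢ` and `Πᵇᵢ` are stable under relabelling of variables (Buss 1986, §2.1: the classes are
closed under renaming of variables; simultaneous induction). [cite: Buss1986, §2.1] -/
theorem IsSigmab.relabel_and_IsPib_relabel (i : ℕ) :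
    (∀ {n : ℕ} {φ : Language.boundedArith.BoundedFormula α n}, IsSigmab i φ →
      ∀ {m : ℕ} (g : α → β ⊕ Fin m), IsSigmab i (φ.relabel g)) ∧
    (∀ {n : ℕ} {φ : Language.boundedArith.BoundedFormula α n}, IsPib i φ →
      ∀ {m : ℕ} (g : α → β ⊕ Fin m), IsPib i (φ.relabel g)) := by
  constructor
  · intro n φ h
    refine IsSigmab.rec
      (motive_1 := fun i n φ _ => ∀ {m : ℕ} (g : α → β ⊕ Fin m), IsSigmab i (φ.relabel g))
      (motive_2 := fun i n φ _ => ∀ {m : ℕ} (g : α → β ⊕ Fin m), IsPib i (φ.relabel g))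
      ?_ ?_ ?_ ?_ ?_ ?_ ?_ ?_ ?_ ?_ h
    · exact fun h _ g => .of_isSharplyBounded (h.relabel g)
    · exact fun _ ih _ g => .of_isPib (ih g)
    · intro i n φ ψ _ _ ih₁ ih₂ m g
      rw [relabel_imp]
      exact .imp (ih₁ g) (ih₂ g)
    · intro i n t φ _ ih m g
      rw [relabel_bexLE]
      exact .bexLE _ (ih g)
    · intro i n t φ _ ih m g
      rw [relabel_ballLELen]
      exact .ballLELen _ (ih g)
    · exact fun h _ g => .of_isSharplyBounded (h.relabel g)
    · exact fun _ ih _ g => .of_isSigmab (ih g)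
    · intro i n φ ψ _ _ ih₁ ih₂ m g
      rw [relabel_imp]
      exact .imp (ih₁ g) (ih₂ g)
    · intro i n t φ _ ih m g
      rw [relabel_ballLE]
      exact .ballLE _ (ih g)
    · intro i n t φ _ ih m g
      rw [relabel_bexLELen]
      exact .bexLELen _ (ih g)
  · intro n φ h
    refine IsPib.rec
      (motive_1 := fun i n φ _ => ∀ {m : ℕ} (g : α → β ⊕ Fin m), IsSigmab i (φ.relabel g))
      (motive_2 := fun i n φ _ => ∀ {m : ℕ} (g : α → β ⊕ Fin m), IsPib i (φ.relabel g))
      ?_ ?_ ?_ ?_ ?_ ?_ ?_ ?_ ?_ ?_ h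
    · exact fun h _ g => .of_isSharplyBounded (h.relabel g)
    · exact fun _ ih _ g => .of_isPib (ih g)
    · intro i n φ ψ _ _ ih₁ ih₂ m g
      rw [relabel_imp]
      exact .imp (ih₁ g) (ih₂ g)
    · intro i n t φ _ ih m g
      rw [relabel_bexLE]
      exact .bexLE _ (ih g)
    · intro i n t φ _ ih m g
      rw [relabel_ballLELen]
      exact .ballLELen _ (ih g)
    · exact fun h _ g => .of_isSharplyBounded (h.relabel g)
    · exact fun _ ih _ g => .of_isSigmab (ih g)
    · intro i n φ ψ _ _ ih₁ ih₂ m g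
      rw [relabel_imp]
      exact .imp (ih₁ g) (ih₂ g)
    · intro i n t φ _ ih m g
      rw [relabel_ballLE]
      exact .ballLE _ (ih g)
    · intro i n t φ _ ih m g
      rw [relabel_bexLELen]
      exact .bexLELen _ (ih g)

/-- `Σᵇᵢ` is stable under relabelling of variables (Buss 1986, §2.1). [cite: Buss1986, §2.1] -/
theorem IsSigmab.relabel {i : ℕ} {φ : Language.boundedArith.BoundedFormula α n}
    (h : IsSigmab i φ) (g : α → β ⊕ Fin m) : IsSigmab i (φ.relabel g) :=
  (IsSigmab.relabel_and_IsPib_relabel i).1 h g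

/-- `Πᵇᵢ` is stable under relabelling of variables (Buss 1986, §2.1). [cite: Buss1986, §2.1] -/
theorem IsPib.relabel {i : ℕ} {φ : Language.boundedArith.BoundedFormula α n}
    (h : IsPib i φ) (g : α → β ⊕ Fin m) : IsPib i (φ.relabel g) :=
  (IsSigmab.relabel_and_IsPib_relabel i).2 h g

/-- Bounded formulas are stable under relabelling of variables (Buss 1986, §2.1).
[cite: Buss1986, §2.1] -/
theorem IsBounded.relabel {φ : Language.boundedArith.BoundedFormula α n} (h : IsBounded φ) :
    ∀ {m : ℕ} (g : α → β ⊕ Fin m), IsBounded (φ.relabel g) := by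
  induction h with
  | of_isQF h => exact fun g => .of_isQF (h.relabel g)
  | imp _ _ ih₁ ih₂ =>
    intro m g
    rw [relabel_imp]
    exact .imp (ih₁ g) (ih₂ g)
  | ballLE t _ ih =>
    intro m g
    rw [relabel_ballLE]
    exact .ballLE _ (ih g)
  | bexLE t _ ih =>
    intro m g
    rw [relabel_bexLE]
    exact .bexLE _ (ih g)

/-- `Σᵇᵢ` is stable under renaming the free variables of a formula (`Formula.relabel`)
(Buss 1986, §2.1). [cite: Buss1986, §2.1] -/
theorem IsSigmab.formulaRelabel {i : ℕ} {φ : Language.boundedArith.Formula α} (h : IsSigmab i φ)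
    (g : α → β) : IsSigmab i (φ.relabel g) :=
  h.relabel _

/-- `Πᵇᵢ` is stable under renaming the free variables of a formula (`Formula.relabel`)
(Buss 1986, §2.1). [cite: Buss1986, §2.1] -/
theorem IsPib.formulaRelabel {i : ℕ} {φ : Language.boundedArith.Formula α} (h : IsPib i φ)
    (g : α → β) : IsPib i (φ.relabel g) :=
  h.relabel _

/-- Sharply bounded formulas are stable under renaming the free variables of a formula
(`Formula.relabel`) (Buss 1986, §2.1). [cite: Buss1986, §2.1] -/
theorem IsSharplyBounded.formulaRelabel {φ : Language.boundedArith.Formula α}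
    (h : IsSharplyBounded φ) (g : α → β) : IsSharplyBounded (φ.relabel g) :=
  h.relabel _

end BoundedArith


/-! ## Substitution of terms for the free variables -/

section SubstGeneral

variable {L : Language} {α β : Type} {n : ℕ}

/-- Substituting into a relabelled term. [folklore] -/
private theorem subst_relabel_term {γ δ ε : Type} (r : γ → δ) (τ : δ → L.Term ε) (t : L.Term γ) :
    (t.relabel r).subst τ = t.subst (τ ∘ r) := by
  induction t with
  | var x => rfl
  | func f ts ih =>
    simp only [Term.relabel, Term.subst]
    congr 1
    funext j
    exact ih j

/-- Relabelling a substituted term. [folklore] -/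
private theorem relabel_subst_term {γ δ ε : Type} (τ : γ → L.Term δ) (r : δ → ε) (t : L.Term γ) :
    (t.subst τ).relabel r = t.subst (fun x => (τ x).relabel r) := by
  induction t with
  | var x => rfl
  | func f ts ih =>
    simp only [Term.relabel, Term.subst]
    congr 1
    funext j
    exact ih j

/-- Weakening a term by a new last context variable commutes with substitution for the free
variables. [folklore] -/
theorem subst_relabel_castSucc (σ : α → L.Term β) (t : L.Term (α ⊕ Fin n)) :
    (t.relabel (Sum.map id Fin.castSucc)).subst
        (Sum.elim (Term.relabel Sum.inl ∘ σ) (var ∘ Sum.inr)) =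
      (t.subst (Sum.elim (Term.relabel Sum.inl ∘ σ) (var ∘ Sum.inr))).relabel
        (Sum.map id Fin.castSucc) := by
  rw [subst_relabel_term, relabel_subst_term]
  congr 1
  funext x
  rcases x with a | k
  · simp only [Function.comp_apply, Sum.map_inl, id_eq, Sum.elim_inl, Term.relabel_relabel]
    rfl
  · rfl

/-- Quantifier-free formulas are stable under substitution of terms for the free variables
(the analogue of Mathlib's `IsQF.relabel`; stated in this namespace). [folklore] -/
theorem isQF_subst {m : ℕ} {φ : L.BoundedFormula α m} (h : φ.IsQF) (σ : α → L.Term β) :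
    (φ.subst σ).IsQF := by
  induction h with
  | falsum => exact IsQF.falsum
  | of_isAtomic h =>
    cases h with
    | equal t₁ t₂ => exact (BoundedFormula.IsAtomic.equal _ _).isQF
    | rel R ts => exact (BoundedFormula.IsAtomic.rel _ _).isQF
  | imp _ _ ih₁ ih₂ => exact ih₁.imp ih₂

/-- Substitution commutes with implication. [folklore] -/
@[simp] theorem subst_imp (σ : α → L.Term β) (φ ψ : L.BoundedFormula α n) :
    (φ ⟹ ψ).subst σ = (φ.subst σ ⟹ ψ.subst σ) := rfl

/-- Substitution commutes with `⊥`. [folklore] -/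
@[simp] theorem subst_bot (σ : α → L.Term β) : (⊥ : L.BoundedFormula α n).subst σ = ⊥ := rfl

/-- Substitution commutes with the universal quantifier. [folklore] -/
@[simp] theorem subst_all (σ : α → L.Term β) (φ : L.BoundedFormula α (n + 1)) :
    (∀' φ).subst σ = ∀' (φ.subst σ) := rfl

/-- Substitution commutes with negation. [folklore] -/
@[simp] theorem subst_not (σ : α → L.Term β) (φ : L.BoundedFormula α n) :
    (∼φ).subst σ = ∼(φ.subst σ) := rfl

/-- Substitution commutes with the existential quantifier. [folklore] -/
@[simp] theorem subst_ex (σ : α → L.Term β) (φ : L.BoundedFormula α (n + 1)) :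
    (∃' φ).subst σ = ∃' (φ.subst σ) := rfl

variable [L.IsOrdered]

/-- Substituting into an atomic inequality `t₁ ≤ t₂`. [folklore] -/
theorem subst_le (σ : α → L.Term β) (t₁ t₂ : L.Term (α ⊕ Fin n)) :
    (Term.le t₁ t₂ : L.BoundedFormula α n).subst σ =
      Term.le (t₁.subst (Sum.elim (Term.relabel Sum.inl ∘ σ) (var ∘ Sum.inr)))
        (t₂.subst (Sum.elim (Term.relabel Sum.inl ∘ σ) (var ∘ Sum.inr))) := by
  simp only [Term.le, Relations.boundedFormula₂, Relations.boundedFormula]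
  rw [BoundedFormula.subst]
  simp only [mapTermRel, id_eq]
  congr 1
  funext i
  fin_cases i <;> rfl

/-- Substitution commutes with the bounded universal quantifier. [folklore] -/
@[simp] theorem subst_ballLE (σ : α → L.Term β) (t : L.Term (α ⊕ Fin n))
    (φ : L.BoundedFormula α (n + 1)) :
    (ballLE t φ).subst σ =
      ballLE (t.subst (Sum.elim (Term.relabel Sum.inl ∘ σ) (var ∘ Sum.inr))) (φ.subst σ) := by
  simp only [ballLE, subst_all, subst_imp, subst_le, Function.comp_apply, Term.subst,
    Sum.elim_inr, subst_relabel_castSucc]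

/-- Substitution commutes with the bounded existential quantifier. [folklore] -/
@[simp] theorem subst_bexLE (σ : α → L.Term β) (t : L.Term (α ⊕ Fin n))
    (φ : L.BoundedFormula α (n + 1)) :
    (bexLE t φ).subst σ =
      bexLE (t.subst (Sum.elim (Term.relabel Sum.inl ∘ σ) (var ∘ Sum.inr))) (φ.subst σ) := by
  simp only [bexLE, subst_ex]
  change ((Term.le _ _ ⊓ φ).subst σ).ex = _
  congr 1
  change ((Term.le _ _ ⟹ (φ ⟹ ⊥)) ⟹ ⊥).subst σ = (Term.le _ _ ⟹ (φ.subst σ ⟹ ⊥)) ⟹ ⊥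
  simp only [subst_imp, subst_bot, subst_le, Function.comp_apply, Term.subst, Sum.elim_inr,
    subst_relabel_castSucc]

end SubstGeneral

section SubstBoundedArith

variable {α β : Type} {n : ℕ}

/-- Substitution commutes with the length term former `|·|`. [folklore] -/
private theorem subst_len {γ δ : Type} (τ : γ → Language.boundedArith.Term δ)
    (t : Language.boundedArith.Term γ) : (Term.len t).subst τ = Term.len (t.subst τ) := by
  simp only [Term.len, Functions.apply₁, Term.subst]
  congr 1
  funext j
  fin_cases j
  rfl

/-- Substitution commutes with the sharply bounded universal quantifier. [folklore] -/
@[simp] theorem subst_ballLELen (σ : α → Language.boundedArith.Term β)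
    (t : Language.boundedArith.Term (α ⊕ Fin n))
    (φ : Language.boundedArith.BoundedFormula α (n + 1)) :
    (ballLELen t φ).subst σ =
      ballLELen (t.subst (Sum.elim (Term.relabel Sum.inl ∘ σ) (var ∘ Sum.inr))) (φ.subst σ) := by
  simp only [ballLELen, subst_ballLE, subst_len]

/-- Substitution commutes with the sharply bounded existential quantifier. [folklore] -/
@[simp] theorem subst_bexLELen (σ : α → Language.boundedArith.Term β)
    (t : Language.boundedArith.Term (α ⊕ Fin n))
    (φ : Language.boundedArith.BoundedFormula α (n + 1)) :
    (bexLELen t φ).subst σ =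
      bexLELen (t.subst (Sum.elim (Term.relabel Sum.inl ∘ σ) (var ∘ Sum.inr))) (φ.subst σ) := by
  simp only [bexLELen, subst_bexLE, subst_len]

/-- Sharply bounded formulas are stable under substitution of terms for the free variables
(Buss 1986, §2.1: the classes are closed under term substitution). [cite: Buss1986, §2.1] -/
theorem IsSharplyBounded.subst {φ : Language.boundedArith.BoundedFormula α n}
    (h : IsSharplyBounded φ) (σ : α → Language.boundedArith.Term β) :
    IsSharplyBounded (φ.subst σ) := by
  induction h with
  | of_isQF h => exact .of_isQF (isQF_subst h σ)
  | imp _ _ ih₁ ih₂ =>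
    rw [subst_imp]
    exact .imp ih₁ ih₂
  | ballLELen t _ ih =>
    rw [subst_ballLELen]
    exact .ballLELen _ ih
  | bexLELen t _ ih =>
    rw [subst_bexLELen]
    exact .bexLELen _ ih

/-- `Σᵇᵢ` and `Πᵇᵢ` are stable under substitution of terms for the free variables (Buss 1986,
§2.1; simultaneous induction). [cite: Buss1986, §2.1] -/
theorem IsSigmab.subst_and_IsPib_subst (i : ℕ) (σ : α → Language.boundedArith.Term β) :
    (∀ {n : ℕ} {φ : Language.boundedArith.BoundedFormula α n}, IsSigmab i φ →
      IsSigmab i (φ.subst σ)) ∧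
    (∀ {n : ℕ} {φ : Language.boundedArith.BoundedFormula α n}, IsPib i φ →
      IsPib i (φ.subst σ)) := by
  constructor
  · intro n φ h
    refine IsSigmab.rec
      (motive_1 := fun i n φ _ => IsSigmab i (φ.subst σ))
      (motive_2 := fun i n φ _ => IsPib i (φ.subst σ))
      ?_ ?_ ?_ ?_ ?_ ?_ ?_ ?_ ?_ ?_ h
    · exact fun h => .of_isSharplyBounded (h.subst σ)
    · exact fun _ ih => .of_isPib ih
    · intro i n φ ψ _ _ ih₁ ih₂
      rw [subst_imp]
      exact .imp ih₁ ih₂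
    · intro i n t φ _ ih
      rw [subst_bexLE]
      exact .bexLE _ ih
    · intro i n t φ _ ih
      rw [subst_ballLELen]
      exact .ballLELen _ ih
    · exact fun h => .of_isSharplyBounded (h.subst σ)
    · exact fun _ ih => .of_isSigmab ih
    · intro i n φ ψ _ _ ih₁ ih₂
      rw [subst_imp]
      exact .imp ih₁ ih₂
    · intro i n t φ _ ih
      rw [subst_ballLE]
      exact .ballLE _ ih
    · intro i n t φ _ ih
      rw [subst_bexLELen]
      exact .bexLELen _ ih
  · intro n φ h
    refine IsPib.rec
      (motive_1 := fun i n φ _ => IsSigmab i (φ.subst σ))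
      (motive_2 := fun i n φ _ => IsPib i (φ.subst σ))
      ?_ ?_ ?_ ?_ ?_ ?_ ?_ ?_ ?_ ?_ h
    · exact fun h => .of_isSharplyBounded (h.subst σ)
    · exact fun _ ih => .of_isPib ih
    · intro i n φ ψ _ _ ih₁ ih₂
      rw [subst_imp]
      exact .imp ih₁ ih₂
    · intro i n t φ _ ih
      rw [subst_bexLE]
      exact .bexLE _ ih
    · intro i n t φ _ ih
      rw [subst_ballLELen]
      exact .ballLELen _ ih
    · exact fun h => .of_isSharplyBounded (h.subst σ)
    · exact fun _ ih => .of_isSigmab ih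
    · intro i n φ ψ _ _ ih₁ ih₂
      rw [subst_imp]
      exact .imp ih₁ ih₂
    · intro i n t φ _ ih
      rw [subst_ballLE]
      exact .ballLE _ ih
    · intro i n t φ _ ih
      rw [subst_bexLELen]
      exact .bexLELen _ ih

/-- `Σᵇᵢ` is stable under substitution of terms for the free variables (Buss 1986, §2.1).
[cite: Buss1986, §2.1] -/
theorem IsSigmab.subst {i : ℕ} {φ : Language.boundedArith.BoundedFormula α n}
    (h : IsSigmab i φ) (σ : α → Language.boundedArith.Term β) : IsSigmab i (φ.subst σ) :=
  (IsSigmab.subst_and_IsPib_subst i σ).1 h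

/-- `Πᵇᵢ` is stable under substitution of terms for the free variables (Buss 1986, §2.1).
[cite: Buss1986, §2.1] -/
theorem IsPib.subst {i : ℕ} {φ : Language.boundedArith.BoundedFormula α n}
    (h : IsPib i φ) (σ : α → Language.boundedArith.Term β) : IsPib i (φ.subst σ) :=
  (IsSigmab.subst_and_IsPib_subst i σ).2 h

/-- Bounded formulas are stable under substitution of terms for the free variables
(Buss 1986, §2.1). [cite: Buss1986, §2.1] -/
theorem IsBounded.subst {φ : Language.boundedArith.BoundedFormula α n} (h : IsBounded φ)
    (σ : α → Language.boundedArith.Term β) : IsBounded (φ.subst σ) := by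
  induction h with
  | of_isQF h => exact .of_isQF (isQF_subst h σ)
  | imp _ _ ih₁ ih₂ =>
    rw [subst_imp]
    exact .imp ih₁ ih₂
  | ballLE t _ ih =>
    rw [subst_ballLE]
    exact .ballLE _ ih
  | bexLE t _ ih =>
    rw [subst_bexLE]
    exact .bexLE _ ih

end SubstBoundedArith

end Literature.Computability.MetaComplexity
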